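import Summits.NavierStokesRegularity.NavierStokesRegularity.Theses.AxisymmetricExtremality
import Summits.NavierStokesRegularity.NavierStokesRegularity.Theorems.AxisymmetricExtremalityAxisymmetricKatoGlobalStubSereginLogSwirlOriginStep3CutoffCalculus
import Literature.Analysis.FluidPDE.BiotSavartCurlPair
import Literature.Analysis.FluidPDE.AxisymGradientField
import Literature.Analysis.FluidPDE.SwirlTransportProofs
import HarnessLib

/-!
# Seregin 2022, §2 Step 3: the stream form `A₃ = ∫⟪v, ∇(η⁶Φ) × ∇(v_r/r)⟫` of the source term of the
# `Φ`-equation, and the axisymmetric cross-product bound `|⟪v, ∇p × ∇q⟫| ≤ |v_θ| |∇p| |∇q|` —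
# crux stmt-NavierStokesRegularity-15453 (`AxisymmetricExtremality.AxisymmetricKatoGlobal`), line registered, support for stub `stub_sereginLogSwirlOrigin`

Support file (`--supports stmt-NavierStokesRegularity-15453`; theorems only, everything proved)
toward the registered stub `stub_sereginLogSwirlOrigin` = the named fact
`Literature.Analysis.FluidPDE.seregin2022_logSwirl_regularAtOrigin` (G. Seregin, J. Math. Fluid
Mech. 24 (2022), Paper 27 = arXiv:2201.00153, §2). In Step 3 (arXiv p. 6) the source
`ω·∇(v_r/r)` of the `Φ`-equation, paired with `Φη⁶`, is integrated by parts into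
"`A₃ = ∫(v_θ(v_r/r),₃(Φη⁶),ᵣ − v_θ(v_r/r),ᵣ(Φη⁶),₃)dx`": only the azimuthal velocity `v_θ`
survives, which is what makes the swirl condition (2.2) effective. This file gives the Cartesian
form of that computation:

* `integral_mul_fderiv_apply_curl_eq` (registered sub-goal) — **the stream form**: for `v ∈ C¹`,
  `f ∈ C¹_c`, `W ∈ C²`, `∫ f · DW[curl v] = ∫ ⟪v, ∇f × ∇W⟫` (the curl is self-adjoint,
  `integral_inner_curl_eq_integral_inner_curl`, and `curl (f∇W) = ∇f × ∇W`, `curl_smul_gradient'`);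
* `abs_inner_cross_le_of_orthogonal_rotGen`, `abs_inner_cross_gradient_le` (registered sub-goal) —
  **only `v_θ` pairs with `∇p × ∇q`**: for axisymmetric scalars `p, q` (so `∇p, ∇q ⊥ Jx`,
  `IsAxisymmetricScalar.fderiv_rotGen`) and any `u`, off the axis
  `|⟪u, ∇p × ∇q⟫| ≤ (|x₀u₁ − x₁u₀|/r)‖∇p‖‖∇q‖ = |u_θ|‖∇p‖‖∇q‖` (the polynomial identity
  `r²⟪u, a × b⟫ = ⟪Jx, u⟫⟪Jx, a × b⟫` for `a, b ⊥ Jx`, and `|⟪Jx, c⟫| ≤ r‖c‖`, `‖a × b‖ ≤ ‖a‖‖b‖`);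
* tools: `det_gradient_eq_zero_of_isAxisymmetricScalar`, `contDiff_one_gradient'`,
  `curl_smul_gradient'`, and the real-arithmetic lemmas `near_axis_scalar`, `pointwise_scalar`,
  `final_scalar` used by the `A₃` bound (`…Step3SourcePhi`); private copies of folklore
  coordinates/norm facts (`cross` coordinates, `⟪u,w⟫ = Σuᵢwᵢ`, `‖a × b‖ ≤ ‖a‖‖b‖`, Young).

## Mathlib / tree search

Tree: `integral_inner_curl_eq_integral_inner_curl`, `curl_smul`, `contDiff_curl`
(`VorticityCalculus`), `curl_gradient_eq_zero_holds`, `cross`, `norm_cross`, `crossCLM`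
(`VectorCalculus`), `fderiv_eq_innerSL_gradient` (`BiotSavartCurlPair`), `curlCLM_smulRight_innerSL`
(`BiotSavartNewtonKernel`), `gradient_apply_eq_fderiv_single`, `norm_gradient_sq`
(`AxisymGradientField`), `IsAxisymmetricScalar.fderiv_rotGen`, `rotGen_eq_sub_single`,
`swirl_eq_cylRadius_mul_swirlVelocity` (`SwirlTransportProofs`, `AxisymmetricEuler`); the
Lei–Zhang 2011 analogue `integral_mul_inner_gradient_eq_integral_inner_sub_cross`,
`curl_smul_gradient`, `abs_inner_sub_cross_gradient_le` (`LeiZhang2011Proofs`, there with a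
compactly supported `ψ` and without axisymmetry). `lean search 'inner_cross_gradient|fderiv_apply_curl_eq'`:
no matches in this namespace (2026-08-17).

## References

* G. Seregin, J. Math. Fluid Mech. 24 (2022), Paper No. 27 = arXiv:2201.00153, §2 Step 3
  (arXiv p. 6, the term `A₃`). [`Seregin2022LocalAxisym`]
-/

noncomputable section

open MeasureTheory Set Filter Topology Function Metric
open scoped ENNReal ContDiff RealInnerProductSpace
open Literature.Analysis.FluidPDE

-- `<Problem> = <Summit>` duplicates a namespace component by design (lakefile sets the same option).
set_option linter.dupNamespace false

namespace Summit.NavierStokesRegularity.NavierStokesRegularity.Theorems.AxisymmetricKatoGlobal.EulerScaling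

/-! ### The stream form of `A₃` -/

section Stream

variable {v : EuclideanSpace ℝ (Fin 3) → EuclideanSpace ℝ (Fin 3)} {f W : EuclideanSpace ℝ (Fin 3) → ℝ}

/-- `∇W ∈ C¹` for `W ∈ C²` (Riesz isometry after `D`). [folklore] -/
theorem contDiff_one_gradient' (hW : ContDiff ℝ 2 W) : ContDiff ℝ 1 (gradient W) :=
  (InnerProductSpace.toDual ℝ (EuclideanSpace ℝ (Fin 3))).symm.contDiff.comp
    (hW.fderiv_right (m := 1) (by norm_num))

/-- `DW(x) w = ⟪∇W(x), w⟫`. [folklore] -/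
private theorem fderiv_apply_eq_inner_gradient (W : EuclideanSpace ℝ (Fin 3) → ℝ) (x w : EuclideanSpace ℝ (Fin 3)) :
    fderiv ℝ W x w = ⟪gradient W x, w⟫ := by
  rw [fderiv_eq_innerSL_gradient]; rfl

/-- **`curl (f ∇W) = ∇f × ∇W`** at every point, for `f` differentiable and `W ∈ C²`
(`curl (φ F) = φ curl F + ∇φ × F`, `curl ∇W = 0`). [folklore] -/
theorem curl_smul_gradient' (hf : Differentiable ℝ f) (hW : ContDiff ℝ 2 W) (x : EuclideanSpace ℝ (Fin 3)) :
    curl (fun y => f y • gradient W y) x = cross (gradient f x) (gradient W x) := by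
  have hgW : DifferentiableAt ℝ (gradient W) x :=
    ((contDiff_one_gradient' hW).differentiable one_ne_zero) x
  rw [curl_smul (hf x) hgW, curl_gradient_eq_zero_holds W hW x, smul_zero, zero_add,
    fderiv_eq_innerSL_gradient, curlCLM_smulRight_innerSL]

/-- **The stream form of Seregin's `A₃`** (arXiv:2201.00153 p. 6: the source `ω·∇(v_r/r)` of the
`Φ`-equation paired with `Φη⁶` becomes
`A₃ = ∫(v_θ(v_r/r),₃(Φη⁶),ᵣ − v_θ(v_r/r),ᵣ(Φη⁶),₃)dx` after integration by parts). Cartesian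
form: for `v ∈ C¹`, `f ∈ C¹_c` (`f = η⁶Φ`) and `W ∈ C²` (`W = v_r/r`),
`∫ f · DW[curl v] = ∫ ⟪v, ∇f × ∇W⟫` (the curl is self-adjoint,
`integral_inner_curl_eq_integral_inner_curl`, and `curl (f∇W) = ∇f × ∇W`).
[cite: Seregin2022LocalAxisym, §2 Step 3 (arXiv:2201.00153 p. 6, the term A₃)] -/
theorem integral_mul_fderiv_apply_curl_eq : ∀ (v : EuclideanSpace ℝ (Fin 3) → EuclideanSpace ℝ (Fin 3)) (f W : EuclideanSpace ℝ (Fin 3) → ℝ), ContDiff ℝ 1 v → ContDiff ℝ 1 f → HasCompactSupport f → ContDiff ℝ 2 W → ∫ x, f x * fderiv ℝ W x (curl v x) = ∫ x, inner ℝ (v x) (cross (gradient f x) (gradient W x)) := by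
  intro v f W hv hf hfc hW
  have hΨ : ContDiff ℝ 1 fun y => f y • gradient W y := hf.smul (contDiff_one_gradient' hW)
  have hΨc : HasCompactSupport fun y => f y • gradient W y := hfc.smul_right
  have h := integral_inner_curl_eq_integral_inner_curl hv hΨ hΨc
  have hL : ∫ x, f x * fderiv ℝ W x (curl v x) = ∫ x, ⟪curl v x, f x • gradient W x⟫ :=
    integral_congr_ae (Eventually.of_forall fun x => by
      simp only
      rw [real_inner_smul_right, fderiv_apply_eq_inner_gradient, real_inner_comm])
  rw [hL, h]
  exact integral_congr_ae (Eventually.of_forall fun x => by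
    simp only
    rw [curl_smul_gradient' (hf.differentiable one_ne_zero) hW x])

end Stream

/-! ### The axisymmetric cross product: only `v_θ` pairs with `∇p × ∇q` -/

section Cross

/-- Coordinates of the cross product. [folklore] -/
private theorem cross_apply_coords (a b : EuclideanSpace ℝ (Fin 3)) :
    cross a b 0 = a 1 * b 2 - a 2 * b 1 ∧ cross a b 1 = a 2 * b 0 - a 0 * b 2 ∧
      cross a b 2 = a 0 * b 1 - a 1 * b 0 := by
  refine ⟨?_, ?_, ?_⟩ <;> simp [cross, cross_apply]

/-- `⟪u, w⟫ = u₀w₀ + u₁w₁ + u₂w₂` on `ℝ³`. [folklore] -/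
private theorem real_inner_eq_sum_three (u w : EuclideanSpace ℝ (Fin 3)) :
    ⟪u, w⟫ = u 0 * w 0 + u 1 * w 1 + u 2 * w 2 := by
  simp only [PiLp.inner_apply, Fin.sum_univ_three, RCLike.inner_apply, conj_trivial]
  ring

/-- `‖a × b‖ ≤ ‖a‖‖b‖`. [folklore] -/
private theorem norm_cross_le (a b : EuclideanSpace ℝ (Fin 3)) : ‖cross a b‖ ≤ ‖a‖ * ‖b‖ := by
  rw [norm_cross]
  exact mul_le_of_le_one_right (mul_nonneg (norm_nonneg _) (norm_nonneg _)) (Real.sin_le_one _)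

/-- `‖w‖² = w₀² + w₁² + w₂²` on `ℝ³`. [folklore] -/
private theorem norm_sq_eq_sum_three' (w : EuclideanSpace ℝ (Fin 3)) :
    ‖w‖ ^ 2 = w 0 ^ 2 + w 1 ^ 2 + w 2 ^ 2 := by
  rw [EuclideanSpace.norm_eq, Real.sq_sqrt (by positivity), Fin.sum_univ_three]
  simp only [Real.norm_eq_abs, sq_abs]

/-- `|x₀w₁ − x₁w₀| ≤ r ‖w‖` (planar Cauchy–Schwarz, `r = cylRadius x`). [folklore] -/
private theorem abs_det_le_cylRadius_mul_norm (x w : EuclideanSpace ℝ (Fin 3)) :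
    |x 0 * w 1 - x 1 * w 0| ≤ cylRadius x * ‖w‖ := by
  have hw : w 0 ^ 2 + w 1 ^ 2 ≤ ‖w‖ ^ 2 := by
    rw [norm_sq_eq_sum_three']; nlinarith [sq_nonneg (w 2)]
  have hr : cylRadius x ^ 2 = x 0 ^ 2 + x 1 ^ 2 := (sq_add_sq_eq_cylRadius_sq x).symm
  have h2 : (x 0 * w 1 - x 1 * w 0) ^ 2 ≤ (x 0 ^ 2 + x 1 ^ 2) * (w 0 ^ 2 + w 1 ^ 2) := by
    nlinarith [sq_nonneg (x 0 * w 0 + x 1 * w 1)]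
  have hnn : 0 ≤ cylRadius x * ‖w‖ := mul_nonneg (cylRadius_nonneg x) (norm_nonneg w)
  have h3 : (x 0 * w 1 - x 1 * w 0) ^ 2 ≤ (cylRadius x * ‖w‖) ^ 2 := by
    rw [mul_pow, hr]
    exact h2.trans (mul_le_mul_of_nonneg_left hw (by positivity))
  exact abs_le.2 (abs_le_of_sq_le_sq' h3 hnn)

/-- **Only the azimuthal component pairs with `∇p × ∇q`.** If `a, b ∈ ℝ³` are orthogonal to the
rotation generator `Jx = (−x₁, x₀, 0)` (`x₀a₁ − x₁a₀ = 0`, likewise `b`; e.g. gradients of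
axisymmetric scalars, `IsAxisymmetricScalar.fderiv_rotGen`), then `a × b ∥ Jx`, so for every `u`,
`r²⟪u, a × b⟫ = ⟪Jx, u⟫⟪Jx, a × b⟫` and hence, off the axis,
`|⟪u, a × b⟫| ≤ (|x₀u₁ − x₁u₀|/r) ‖a‖‖b‖ = |u_θ| ‖a‖‖b‖`. [folklore] -/
theorem abs_inner_cross_le_of_orthogonal_rotGen (u a b x : EuclideanSpace ℝ (Fin 3))
    (hr : cylRadius x ≠ 0) (ha : x 0 * a 1 - x 1 * a 0 = 0) (hb : x 0 * b 1 - x 1 * b 0 = 0) :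
    |⟪u, cross a b⟫| ≤ |x 0 * u 1 - x 1 * u 0| / cylRadius x * (‖a‖ * ‖b‖) := by
  obtain ⟨hc0, hc1, hc2⟩ := cross_apply_coords a b
  set c := cross a b with hc
  have hrpos : 0 < cylRadius x := lt_of_le_of_ne (cylRadius_nonneg x) (Ne.symm hr)
  have hr2 : cylRadius x ^ 2 = x 0 ^ 2 + x 1 ^ 2 := (sq_add_sq_eq_cylRadius_sq x).symm
  -- the key polynomial identity
  have hkey : (x 0 ^ 2 + x 1 ^ 2) * ⟪u, c⟫ = (x 0 * u 1 - x 1 * u 0) * (x 0 * c 1 - x 1 * c 0) := by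
    rw [real_inner_eq_sum_three, hc0, hc1, hc2]
    linear_combination ((x 0 * u 0 + x 1 * u 1) * b 2 - u 2 * (x 0 * b 0 + x 1 * b 1)) * ha +
      (-(x 0 * u 0 + x 1 * u 1) * a 2 + u 2 * (x 0 * a 0 + x 1 * a 1)) * hb
  have hdet := abs_det_le_cylRadius_mul_norm x c
  have hcn : ‖c‖ ≤ ‖a‖ * ‖b‖ := norm_cross_le a b
  have h1 : cylRadius x ^ 2 * |⟪u, c⟫| ≤ |x 0 * u 1 - x 1 * u 0| * (cylRadius x * (‖a‖ * ‖b‖)) := by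
    have := congrArg (fun z => |z|) hkey
    simp only [abs_mul] at this
    rw [← hr2, abs_of_nonneg (sq_nonneg _)] at this
    rw [this]
    exact mul_le_mul_of_nonneg_left (hdet.trans (mul_le_mul_of_nonneg_left hcn hrpos.le)) (abs_nonneg _)
  rw [div_mul_eq_mul_div, le_div_iff₀ hrpos]
  nlinarith [h1, hrpos, abs_nonneg ⟪u, c⟫]

/-- For an axisymmetric scalar `p` differentiable at `x`, `∇p(x) ⊥ Jx`:
`x₀ ∂₁p − x₁ ∂₀p = 0`. [folklore] -/
theorem det_gradient_eq_zero_of_isAxisymmetricScalar {p : EuclideanSpace ℝ (Fin 3) → ℝ}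
    (hp : IsAxisymmetricScalar p) {x : EuclideanSpace ℝ (Fin 3)} (hd : DifferentiableAt ℝ p x) :
    x 0 * gradient p x 1 - x 1 * gradient p x 0 = 0 := by
  have h := hp.fderiv_rotGen hd
  rw [rotGen_eq_sub_single, map_sub, map_smul, map_smul, smul_eq_mul, smul_eq_mul] at h
  rw [gradient_apply_eq_fderiv_single, gradient_apply_eq_fderiv_single]
  linarith

/-- **The pointwise bound for the `A₃`-type integrands**: for axisymmetric scalars `p, q`
differentiable at an off-axis point `x` and any field value `u`,
`|⟪u, ∇p(x) × ∇q(x)⟫| ≤ (|swirl|/r) ‖∇p(x)‖ ‖∇q(x)‖` (`swirl = x₀u₁ − x₁u₀ = r u_θ`). [folklore] -/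
theorem abs_inner_cross_gradient_le : ∀ (p q : EuclideanSpace ℝ (Fin 3) → ℝ) (x u : EuclideanSpace ℝ (Fin 3)), IsAxisymmetricScalar p → IsAxisymmetricScalar q → cylRadius x ≠ 0 → DifferentiableAt ℝ p x → DifferentiableAt ℝ q x → |inner ℝ u (cross (gradient p x) (gradient q x))| ≤ |x 0 * u 1 - x 1 * u 0| / cylRadius x * (‖gradient p x‖ * ‖gradient q x‖) :=
  fun _ _ x u hp hq hr hpd hqd => abs_inner_cross_le_of_orthogonal_rotGen u _ _ x hr
    (det_gradient_eq_zero_of_isAxisymmetricScalar hp hpd)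
    (det_gradient_eq_zero_of_isAxisymmetricScalar hq hqd)

end Cross

/-! ### The real arithmetic of the `A₃` bound -/

section Scalars

variable {u : EuclideanSpace ℝ (Fin 3) → EuclideanSpace ℝ (Fin 3)} {ζ : EuclideanSpace ℝ (Fin 3) → ℝ}

/-- Young: `P a ≤ ε a² + P²/(4ε)` for `ε > 0`. [folklore] -/
private theorem mul_le_eps_sq_add (P a : ℝ) {ε : ℝ} (hε : 0 < ε) : P * a ≤ ε * a ^ 2 + P ^ 2 / (4 * ε) := by
  have h : 0 ≤ ε * (a - P / (2 * ε)) ^ 2 := by positivity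
  have h2 : ε * (a - P / (2 * ε)) ^ 2 = ε * a ^ 2 - P * a + P ^ 2 / (4 * ε) := by
    field_simp
    ring
  linarith [h, h2]

/-- The near-axis scalar step: `|v_θ| ≤ C₁/(rL³)`, `L ≥ L₁` give
`|v_θ| a b ≤ (C₁/(2L₁²))(a² + (b/(rL))²)`. [folklore] -/
theorem near_axis_scalar {s a b C₁ r L L₁ : ℝ} (hs : s ≤ C₁ / (r * L ^ 3)) (hr : 0 < r)
    (hL₁ : 0 < L₁) (hLL : L₁ ≤ L) (hC : 0 ≤ C₁) (ha : 0 ≤ a) (hb : 0 ≤ b) :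
    s * (a * b) ≤ C₁ / (2 * L₁ ^ 2) * a ^ 2 + C₁ / (2 * L₁ ^ 2) * (b / (r * L)) ^ 2 := by
  have hL : 0 < L := by linarith
  have step1 : s * (a * b) ≤ C₁ / (r * L ^ 3) * (a * b) :=
    mul_le_mul_of_nonneg_right hs (by positivity)
  have step2 : C₁ / (r * L ^ 3) * (a * b) = (C₁ / L ^ 2) * (a * (b / (r * L))) := by
    field_simp
  have step3 : C₁ / L ^ 2 ≤ C₁ / L₁ ^ 2 :=
    div_le_div_of_nonneg_left hC (by positivity) (pow_le_pow_left₀ hL₁.le hLL 2)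
  have step4 : a * (b / (r * L)) ≤ (a ^ 2 + (b / (r * L)) ^ 2) / 2 := by
    nlinarith [sq_nonneg (a - b / (r * L))]
  calc s * (a * b) ≤ C₁ / (r * L ^ 3) * (a * b) := step1
    _ = (C₁ / L ^ 2) * (a * (b / (r * L))) := step2
    _ ≤ (C₁ / L₁ ^ 2) * ((a ^ 2 + (b / (r * L)) ^ 2) / 2) :=
        mul_le_mul step3 step4 (by positivity) (by positivity)
    _ = _ := by ring

/-- The pointwise combination of the three `A₃`-terms (pure real arithmetic). [folklore] -/
theorem pointwise_scalar {t0 t1 t2 s a b nz nw w z P₀ P₁ P₂ K q ε : ℝ}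
    (h0 : |t0| ≤ s * (a * b)) (h1 : |t1| ≤ s * (a * nz)) (h2 : |t2| ≤ s * (nz * nw))
    (hP1 : |w| * s * nz ≤ P₁) (hP2 : |z| * s * (nz * nw) ≤ P₂) (hε : 0 < ε) (ha : 0 ≤ a)
    (hK : 0 ≤ K) (hq : 0 ≤ q)
    (hcase : s * (a * b) ≤ K * a ^ 2 + K * q ∨ s * b ≤ P₀) :
    |t0 - w * t1 + z * t2| ≤ (K + 2 * ε) * a ^ 2 + K * q + ((P₀ ^ 2 + P₁ ^ 2) / (4 * ε) + P₂) := by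
  have hY1 : P₁ * a ≤ ε * a ^ 2 + P₁ ^ 2 / (4 * ε) := mul_le_eps_sq_add P₁ a hε
  have hY0 : P₀ * a ≤ ε * a ^ 2 + P₀ ^ 2 / (4 * ε) := mul_le_eps_sq_add P₀ a hε
  have hwt1 : |w * t1| ≤ P₁ * a := by
    rw [abs_mul]
    calc |w| * |t1| ≤ |w| * (s * (a * nz)) := mul_le_mul_of_nonneg_left h1 (abs_nonneg _)
      _ = (|w| * s * nz) * a := by ring
      _ ≤ P₁ * a := mul_le_mul_of_nonneg_right hP1 ha
  have hzt2 : |z * t2| ≤ P₂ := by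
    rw [abs_mul]
    calc |z| * |t2| ≤ |z| * (s * (nz * nw)) := mul_le_mul_of_nonneg_left h2 (abs_nonneg _)
      _ = |z| * s * (nz * nw) := by ring
      _ ≤ P₂ := hP2
  have ht0 : |t0| ≤ (K + ε) * a ^ 2 + K * q + P₀ ^ 2 / (4 * ε) := by
    rcases hcase with hnear | hfar
    · have : 0 ≤ ε * a ^ 2 := by positivity
      have : 0 ≤ P₀ ^ 2 / (4 * ε) := by positivity
      nlinarith [h0, hnear]
    · have hfa : s * (a * b) ≤ P₀ * a := by
        calc s * (a * b) = (s * b) * a := by ring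
          _ ≤ P₀ * a := mul_le_mul_of_nonneg_right hfar ha
      have : 0 ≤ K * a ^ 2 := by positivity
      have : 0 ≤ K * q := by positivity
      linarith [h0, hfa, hY0]
  have htri : |t0 - w * t1 + z * t2| ≤ |t0| + |w * t1| + |z * t2| := by
    have := abs_add_le (t0 - w * t1) (z * t2)
    have := abs_sub t0 (w * t1)
    linarith
  have hP0nn : 0 ≤ P₀ ^ 2 / (4 * ε) := by positivity
  have hsplit : (P₀ ^ 2 + P₁ ^ 2) / (4 * ε) = P₀ ^ 2 / (4 * ε) + P₁ ^ 2 / (4 * ε) := add_div _ _ _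
  linarith [htri, ht0, hwt1, hzt2, hY1, hsplit]

/-- The final combination of the integrated bounds (pure real arithmetic). [folklore] -/
theorem final_scalar {I J DΦ DΓ Qs V C₁ L₁ ε cL CL P₀ P₁ P₂ : ℝ}
    (hJI : J ≤ I)
    (hI : I ≤ (C₁ / (2 * L₁ ^ 2) + 2 * ε) * DΦ + C₁ / (2 * L₁ ^ 2) * Qs +
      ((P₀ ^ 2 + P₁ ^ 2) / (4 * ε) + P₂) * V)
    (hQs : Qs ≤ 4 * (cL * DΓ + CL)) (hC : 0 ≤ C₁) (hL₁ : 0 < L₁) (hε : 0 < ε) (hcL : 0 ≤ cL)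
    (hDΦ : 0 ≤ DΦ) (hDΓ : 0 ≤ DΓ) :
    2 * J ≤ (C₁ * (1 + 4 * cL) / L₁ ^ 2 + 4 * ε) * (DΓ + DΦ) +
      (4 * C₁ * CL / L₁ ^ 2 + ((P₀ ^ 2 + P₁ ^ 2) / (2 * ε) + 2 * P₂) * V) := by
  have hK : 0 ≤ C₁ / (2 * L₁ ^ 2) := by positivity
  have h1 : C₁ / (2 * L₁ ^ 2) * Qs ≤ C₁ / (2 * L₁ ^ 2) * (4 * (cL * DΓ + CL)) :=
    mul_le_mul_of_nonneg_left hQs hK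
  have h2 : 2 * ((C₁ / (2 * L₁ ^ 2) + 2 * ε) * DΦ) ≤ (C₁ * (1 + 4 * cL) / L₁ ^ 2 + 4 * ε) * DΦ := by
    have : 2 * (C₁ / (2 * L₁ ^ 2) + 2 * ε) ≤ C₁ * (1 + 4 * cL) / L₁ ^ 2 + 4 * ε := by
      have : 0 ≤ C₁ * cL / L₁ ^ 2 := by positivity
      have e1 : 2 * (C₁ / (2 * L₁ ^ 2) + 2 * ε) = C₁ / L₁ ^ 2 + 4 * ε := by field_simp; ring
      have e2 : C₁ * (1 + 4 * cL) / L₁ ^ 2 = C₁ / L₁ ^ 2 + 4 * (C₁ * cL / L₁ ^ 2) := by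
        field_simp
      rw [e1, e2]; linarith
    calc 2 * ((C₁ / (2 * L₁ ^ 2) + 2 * ε) * DΦ) = (2 * (C₁ / (2 * L₁ ^ 2) + 2 * ε)) * DΦ := by ring
      _ ≤ _ := mul_le_mul_of_nonneg_right this hDΦ
  have h3 : 2 * (C₁ / (2 * L₁ ^ 2) * (4 * (cL * DΓ + CL))) =
      4 * (C₁ * cL / L₁ ^ 2) * DΓ + 4 * C₁ * CL / L₁ ^ 2 := by
    field_simp
  have h4 : 4 * (C₁ * cL / L₁ ^ 2) * DΓ ≤ (C₁ * (1 + 4 * cL) / L₁ ^ 2 + 4 * ε) * DΓ := by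
    have : 4 * (C₁ * cL / L₁ ^ 2) ≤ C₁ * (1 + 4 * cL) / L₁ ^ 2 + 4 * ε := by
      have e2 : C₁ * (1 + 4 * cL) / L₁ ^ 2 = C₁ / L₁ ^ 2 + 4 * (C₁ * cL / L₁ ^ 2) := by
        field_simp
      have : 0 ≤ C₁ / L₁ ^ 2 := by positivity
      rw [e2]; linarith
    exact mul_le_mul_of_nonneg_right this hDΓ
  have h5 : 2 * (((P₀ ^ 2 + P₁ ^ 2) / (4 * ε) + P₂) * V) = ((P₀ ^ 2 + P₁ ^ 2) / (2 * ε) + 2 * P₂) * V := by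
    field_simp; ring
  nlinarith [hJI, hI, h1, h2, h3, h4, h5]

end Scalars

end Summit.NavierStokesRegularity.NavierStokesRegularity.Theorems.AxisymmetricKatoGlobal.EulerScaling

end
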